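import Summits.NavierStokesRegularity.NavierStokesRegularity.Theorems.SkeletonEquilibrium.Negative.StrainIdentity

/-!
# `SkeletonEquilibrium` (stmt-NavierStokesRegularity-15400): coplanar skeletons drift at the Leray rate

Negative-side support for the crux `FilamentSkeletonRss.SkeletonEquilibrium` (leafhand
`leafhand-ns-filamentskeletonrs-4-g0`, 2026-08-31), generalising the landed
`…Negative.PlanarSubcritical` (all filaments in the HORIZONTAL plane `{z = 0}`) from one special plane to
EVERY affine plane: if all filaments of a configuration lie in a common affine plane
`{y | ⟪y − y₀, ν⟫ = 0}` (`ν ≠ 0` arbitrary — horizontal, vertical through or off the rotation axis, or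
tilted; `y₀` arbitrary) and the per-filament clauses (C², unit speed, `w_j` differentiable) and the
relative-equilibrium system of the crux hold (any `N, γ, α, Γ`), then `w_j′ ≡ ½` on every filament, so no
supercritical clause `c + δ ≤ w_j′(τ*)` with `c ≥ ½`, `δ > 0` can hold (the crux's is `c = 3/2`).

Mechanism (the same one line as the planar case, freed from coordinates): tangents `Ξ_k′σ` and chords
`Ξ_jτ − Ξ_kσ` of a coplanar configuration are all orthogonal to `ν`, and so is the tangent `Ξ_j′τ` at
the evaluation point; three vectors orthogonal to one nonzero vector are linearly dependent, so the
axial component `⟪Ξ_k′σ × (Ξ_jτ′ − Ξ_kσ), Ξ_j′τ⟫` of the Rosenhead–Biot–Savart integrand vanishes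
IDENTICALLY in `τ′` (`inner_cross_eq_zero_of_inner_eq_zero`, from the expansion
`det(a,b,c)‖ν‖² = ⟪a,ν⟫ det(b,c,ν) + ⟪b,ν⟫ det(c,a,ν) + ⟪c,ν⟫ det(a,b,ν)`). Hence the skeleton's
induced velocity along filament `j` is everywhere orthogonal to the FIXED tangent `Ξ_j′τ` (through the
Bochner integral, convergent or not), so is its `τ′`-derivative, and the axial strain of the landed
strain identity `w_j′ = ½ + ⟪(u_skel ∘ Ξ_j)′, Ξ_j′⟫` (`witness_slope_eq`) is zero.

Consequence for both sides of K1: together with `StraightLinesVertical` (straight ⇒ vertical, slope ½),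
`PlanarSubcritical` (horizontal plane) and `CoreGluing.Negative.parallel_lines_not_supercritical`
(axis-parallel arrays), EVERY coplanar class is dead at slope `½` whatever the plane — in particular the
vertical-plane configurations through the axis (the naive "planar hairpin / planar dipole in a meridian
plane" candidates) — and a witness of the crux must be a genuinely NON-PLANAR curved configuration whose
supercritical margin `≥ 1 + δ` is skew mutual or folded self axial strain at the waist
(`witness_axial_strain_ge`).
-/

set_option linter.dupNamespace false

namespace Summit.NavierStokesRegularity.NavierStokesRegularity.Theorems.SkeletonEquilibrium.Negative

open Literature.Analysis.FluidPDE MeasureTheory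
open scoped RealInnerProductSpace InnerProductSpace BigOperators

/-- The triple-product expansion along a fourth vector, dotted back with it:
`det(a,b,c)·‖ν‖² = ⟪a,ν⟫ det(b,c,ν) + ⟪b,ν⟫ det(c,a,ν) + ⟪c,ν⟫ det(a,b,ν)` (coordinate identity).
[folklore] -/
theorem inner_cross_mul_inner_self (a b c ν : EuclideanSpace ℝ (Fin 3)) :
    ⟪cross a b, c⟫ * ⟪ν, ν⟫ =
      ⟪a, ν⟫ * ⟪cross b c, ν⟫ + ⟪b, ν⟫ * ⟪cross c a, ν⟫ + ⟪c, ν⟫ * ⟪cross a b, ν⟫ := by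
  simp only [cross, PiLp.inner_apply, RCLike.inner_apply, conj_trivial, Fin.sum_univ_three,
    cross_apply, Matrix.cons_val_zero, Matrix.cons_val_one, Matrix.cons_val_two,
    Matrix.head_cons, Matrix.tail_cons]
  ring

/-- **Three vectors orthogonal to one nonzero vector have vanishing triple product** (they lie in a
plane). [folklore] -/
theorem inner_cross_eq_zero_of_inner_eq_zero {a b c ν : EuclideanSpace ℝ (Fin 3)} (hν : ν ≠ 0)
    (ha : ⟪a, ν⟫ = 0) (hb : ⟪b, ν⟫ = 0) (hc : ⟪c, ν⟫ = 0) : ⟪cross a b, c⟫ = 0 := by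
  have h := inner_cross_mul_inner_self a b c ν
  rw [ha, hb, hc, zero_mul, zero_mul, zero_mul, add_zero, add_zero] at h
  have hν' : ⟪ν, ν⟫ ≠ 0 := by
    rw [real_inner_self_eq_norm_sq]
    exact pow_ne_zero 2 (norm_ne_zero_iff.mpr hν)
  exact (mul_eq_zero.mp h).resolve_right hν'

/-- If `⟪F σ, c⟫ = 0` identically for a differentiable `F`, then `⟪F′ τ, c⟫ = 0`. [folklore] -/
private theorem inner_deriv_eq_zero_of_forall {F : ℝ → EuclideanSpace ℝ (Fin 3)}
    (hF : Differentiable ℝ F) {c : EuclideanSpace ℝ (Fin 3)} (h : ∀ σ, ⟪F σ, c⟫ = 0) (τ : ℝ) :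
    ⟪deriv F τ, c⟫ = 0 := by
  have h1 : HasDerivAt (fun σ => ⟪F σ, c⟫) (⟪F τ, (0 : EuclideanSpace ℝ (Fin 3))⟫ + ⟪deriv F τ, c⟫) τ :=
    (hF τ).hasDerivAt.inner ℝ (hasDerivAt_const τ c)
  rw [show (fun σ => ⟪F σ, c⟫) = fun _ => (0 : ℝ) from funext h] at h1
  have h2 := h1.unique (hasDerivAt_const τ (0 : ℝ))
  rw [inner_zero_right, zero_add] at h2
  exact h2

/-- **Coplanar skeletons drift at exactly the Leray rate.** If every filament lies in the affine plane
`{y | ⟪y − y₀, ν⟫ = 0}` (`ν ≠ 0`) and the per-filament clauses (C², unit speed, `w_j` differentiable)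
and the relative-equilibrium system of `SkeletonEquilibrium` hold (any `N, γ, α, Γ`), then
`w_j′(τ) = ½` for all `j, τ`. [folklore] -/
theorem coplanar_slope_half {N : ℕ} (γ : Fin N → ℝ) (α Γ : ℝ)
    (Ξ : Fin N → ℝ → EuclideanSpace ℝ (Fin 3)) {y₀ ν : EuclideanSpace ℝ (Fin 3)} (hν : ν ≠ 0)
    (hplane : ∀ k τ, ⟪Ξ k τ - y₀, ν⟫ = 0)
    (hC2 : ∀ j, ContDiff ℝ 2 (Ξ j)) (hunit : ∀ j τ, ‖deriv (Ξ j) τ‖ = 1)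
    (w : Fin N → ℝ → ℝ) (hw : ∀ j, Differentiable ℝ (w j))
    (heq : ∀ j τ, (∑ k : Fin N, (Γ * γ k / (4 * Real.pi)) • ∫ σ : ℝ,
      ((‖Ξ j τ - Ξ k σ‖ ^ 2 + 1) ^ (3 / 2 : ℝ))⁻¹ • cross (deriv (Ξ k) σ) (Ξ j τ - Ξ k σ)) +
      (1 / 2 : ℝ) • Ξ j τ - α • cross (EuclideanSpace.single (2 : Fin 3) (1 : ℝ)) (Ξ j τ) =
      w j τ • deriv (Ξ j) τ)
    (j : Fin N) (τ : ℝ) : deriv (w j) τ = 1 / 2 := by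
  obtain ⟨hFd, hslope⟩ := witness_slope_eq hC2 hunit hw heq j
  set F : ℝ → EuclideanSpace ℝ (Fin 3) := fun τ => ∑ k : Fin N, (Γ * γ k / (4 * Real.pi)) •
    ∫ σ : ℝ, ((‖Ξ j τ - Ξ k σ‖ ^ 2 + 1) ^ (3 / 2 : ℝ))⁻¹ • cross (deriv (Ξ k) σ) (Ξ j τ - Ξ k σ)
    with hFdef
  -- tangents lie in the direction plane `ν^⊥`
  have hT : ∀ k σ, ⟪deriv (Ξ k) σ, ν⟫ = 0 := by
    intro k σ
    have hd : Differentiable ℝ (fun s => Ξ k s - y₀) :=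
      ((hC2 k).differentiable (by norm_num)).sub_const y₀
    have h := inner_deriv_eq_zero_of_forall hd (fun s => hplane k s) σ
    rwa [deriv_sub_const] at h
  -- chords lie in the direction plane `ν^⊥`
  have hchord : ∀ k σ σ', ⟪Ξ j σ' - Ξ k σ, ν⟫ = 0 := by
    intro k σ σ'
    have h : Ξ j σ' - Ξ k σ = (Ξ j σ' - y₀) - (Ξ k σ - y₀) := by abel
    rw [h, inner_sub_left, hplane, hplane, sub_zero]
  -- the induced velocity along the filament is orthogonal to the fixed tangent `Ξ_j′ τ`, for every `σ'`
  have hF : ∀ σ', ⟪F σ', deriv (Ξ j) τ⟫ = 0 := by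
    intro σ'
    have hint : ∀ k : Fin N,
        ⟪(∫ σ : ℝ, ((‖Ξ j σ' - Ξ k σ‖ ^ 2 + 1) ^ (3 / 2 : ℝ))⁻¹ •
          cross (deriv (Ξ k) σ) (Ξ j σ' - Ξ k σ)), deriv (Ξ j) τ⟫ = 0 := by
      intro k
      by_cases hI : Integrable (fun σ : ℝ => ((‖Ξ j σ' - Ξ k σ‖ ^ 2 + 1) ^ (3 / 2 : ℝ))⁻¹ •
          cross (deriv (Ξ k) σ) (Ξ j σ' - Ξ k σ))
      · rw [real_inner_comm, ← integral_inner hI]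
        refine integral_eq_zero_of_ae (Filter.Eventually.of_forall fun σ => ?_)
        show ⟪deriv (Ξ j) τ, _⟫ = (0 : ℝ)
        rw [real_inner_smul_right, real_inner_comm,
          inner_cross_eq_zero_of_inner_eq_zero hν (hT k σ) (hchord k σ σ') (hT j τ), mul_zero]
      · rw [integral_undef hI, inner_zero_left]
    simp only [hFdef, sum_inner, real_inner_smul_left]
    exact Finset.sum_eq_zero fun k _ => by rw [hint k, mul_zero]
  -- hence the axial strain vanishes
  have hstrain : ⟪deriv F τ, deriv (Ξ j) τ⟫ = 0 := inner_deriv_eq_zero_of_forall hFd hF τ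
  rw [hslope τ, hstrain, add_zero]

/-- Hence a coplanar skeleton never meets a supercritical clause `c + δ ≤ w_j′(τ*)` with `c ≥ ½`,
`δ > 0` (the crux: `c = 3/2`). [folklore] -/
theorem coplanar_not_supercritical {N : ℕ} (γ : Fin N → ℝ) (α Γ : ℝ) {c δ : ℝ} (hc : 1 / 2 ≤ c)
    (hδ : 0 < δ)
    (Ξ : Fin N → ℝ → EuclideanSpace ℝ (Fin 3)) {y₀ ν : EuclideanSpace ℝ (Fin 3)} (hν : ν ≠ 0)
    (hplane : ∀ k τ, ⟪Ξ k τ - y₀, ν⟫ = 0)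
    (hC2 : ∀ j, ContDiff ℝ 2 (Ξ j)) (hunit : ∀ j τ, ‖deriv (Ξ j) τ‖ = 1)
    (w : Fin N → ℝ → ℝ) (hw : ∀ j, Differentiable ℝ (w j))
    (heq : ∀ j τ, (∑ k : Fin N, (Γ * γ k / (4 * Real.pi)) • ∫ σ : ℝ,
      ((‖Ξ j τ - Ξ k σ‖ ^ 2 + 1) ^ (3 / 2 : ℝ))⁻¹ • cross (deriv (Ξ k) σ) (Ξ j τ - Ξ k σ)) +
      (1 / 2 : ℝ) • Ξ j τ - α • cross (EuclideanSpace.single (2 : Fin 3) (1 : ℝ)) (Ξ j τ) =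
      w j τ • deriv (Ξ j) τ)
    (j : Fin N) (τs : ℝ) : ¬ (c + δ ≤ deriv (w j) τs) := by
  rw [coplanar_slope_half γ α Γ Ξ hν hplane hC2 hunit w hw heq j τs]
  linarith

/-- **Planes through the origin** (in particular every MERIDIAN plane — a vertical plane through the
rotation axis, the naive home of "planar hairpin / dipole" candidates): all filaments in
`{y | ⟪y, ν⟫ = 0}`, `ν ≠ 0`, admit no supercritical stagnation point. [folklore] -/
theorem centralPlane_not_supercritical {N : ℕ} (γ : Fin N → ℝ) (α Γ : ℝ) {c δ : ℝ}
    (hc : 1 / 2 ≤ c) (hδ : 0 < δ)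
    (Ξ : Fin N → ℝ → EuclideanSpace ℝ (Fin 3)) {ν : EuclideanSpace ℝ (Fin 3)} (hν : ν ≠ 0)
    (hplane : ∀ k τ, ⟪Ξ k τ, ν⟫ = 0)
    (hC2 : ∀ j, ContDiff ℝ 2 (Ξ j)) (hunit : ∀ j τ, ‖deriv (Ξ j) τ‖ = 1)
    (w : Fin N → ℝ → ℝ) (hw : ∀ j, Differentiable ℝ (w j))
    (heq : ∀ j τ, (∑ k : Fin N, (Γ * γ k / (4 * Real.pi)) • ∫ σ : ℝ,
      ((‖Ξ j τ - Ξ k σ‖ ^ 2 + 1) ^ (3 / 2 : ℝ))⁻¹ • cross (deriv (Ξ k) σ) (Ξ j τ - Ξ k σ)) +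
      (1 / 2 : ℝ) • Ξ j τ - α • cross (EuclideanSpace.single (2 : Fin 3) (1 : ℝ)) (Ξ j τ) =
      w j τ • deriv (Ξ j) τ)
    (j : Fin N) (τs : ℝ) : ¬ (c + δ ≤ deriv (w j) τs) :=
  coplanar_not_supercritical γ α Γ hc hδ Ξ (y₀ := 0) hν
    (fun k τ => by rw [sub_zero]; exact hplane k τ) hC2 hunit w hw heq j τs

end Summit.NavierStokesRegularity.NavierStokesRegularity.Theorems.SkeletonEquilibrium.Negative
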